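import Summits.Ventures.YMGap.RobustBall.SummableSmoothing
import Summits.Ventures.YMGap.RobustBall.QuasilocalCovariance
import HarnessLib

/-!
# Venture YMGap, track ROBUST-BALL (tier 2) — the GLOBAL summable Lipschitz vector of the tier-2 smoothing
# and its exponential-profile sums (the rate-`t` bookkeeping of the massive bridge)

HONEST FRAMING. WHAT THIS IS: a venture file (cell `pub-ymgap`, track Y2 ROBUST-BALL, seat ds-3),
strong-coupling LATTICE bookkeeping for the SUMMABLE (infinite-range) member `N β S_W + W` of rb-p1's
weighted ball (`perturbedYMS`). It assembles the seat's `SummableSmoothing` (sitewise Lipschitz bounds +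
quasilocality of `γ^W_Λ F`) and `QuasilocalCovariance.abs_sub_le_tsum_of_isLipBound_of_quasilocal` into:
(1) `crossCoeff_le_of_weighted_row` — a diagonal-free cross coefficient is bounded by its weighted row;
(2) `tsum_exp_profile_modulus_le` — for a vector dominated by `K (A 𝟙_P + ∑_{e ∈ S₁} 𝟙[y ≠ e] ℓ(e, y))`
    with `P` within distance `1` of `S₁` and weighted rows `≤ Λ_t`: summability and
    `∑'_y e^{−t dist(y, T)} δ(y) ≤ K (A #P e^{t} + #S₁ Λ_t) e^{−t m₀}` once `dist(S₁, T) ≥ m₀` (the profile is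
    1-Lipschitz, `linkSetDist_le_add_norm`, so the weight `e^{t‖e − y‖}` absorbs the displacement);
(3) `exists_globalLip_specAvg_perturbedYMS` — for `SU(N)`: the tier-2 smoothing `γ^W_{S₁}F` of a bounded
    measurable `S₁`-local `F` has a GLOBAL SUMMABLE Lipschitz vector `δ ≥ 0`,
    `|γ^W_{S₁}F(σ) − γ^W_{S₁}F(τ)| ≤ ∑'_y δ(y) ‖σ_y − τ_y‖_F` for ALL `σ, τ`, with profile sums
    `∑'_y e^{−t dist(y, T)} δ(y) ≤ Φ e^{−t m₀}`.
The covariance decay itself is `SummableMassiveBridge.lean`. WHAT IT IS NOT: no door, no row, no number of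
the cell; nothing about the continuum or the Clay problem.

References: H. Föllmer, LNM 1362 (1988), Ch. I, Remark (2.17), (2.20), (2.23)–(2.24); H.-O. Georgii (2011),
Prop. 8.8, Remark 8.26.
-/

noncomputable section

open MeasureTheory ProbabilityTheory Function Finset Filter Topology
open scoped NNReal
open Literature.Probability.LatticeModels
open Literature.Probability.LatticeModels.DobrushinMetric
open Literature.MathematicalPhysics.QuantumLattice
open Literature.MathematicalPhysics.QuantumFieldTheory hiding ZdEdge
open Literature.MathematicalPhysics.QuantumFieldTheory.Balaban1983to89
open Literature.MathematicalPhysics.QuantumFieldTheory.Balaban1983to89.StrongCouplingTorusWindow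
open Summit.Ventures.YMGap.ZdSmoothing

namespace Summit.Ventures.YMGap.RobustBall

variable {d N : ℕ}

/-! ### Bookkeeping: the weighted cross load against an exponential distance profile -/

/-- A diagonal-free cross coefficient is bounded by its weighted row: `ℓ(e, y) ≤ Λ_t` for `y ≠ e`
(`e^{t‖e − y‖} ≥ 1`, one term of a nonnegative summable family). -/
theorem crossCoeff_le_of_weighted_row {ℓ : ZdEdge d → ZdEdge d → ℝ} {t Λt : ℝ}
    (hℓ0 : ∀ e y, y ≠ e → 0 ≤ ℓ e y) (ht : 0 ≤ t)
    (hℓs : ∀ e, Summable fun y => (if y = e then 0 else ℓ e y) * Real.exp (t * ‖e.1 - y.1‖))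
    (hℓt : ∀ e, ∑' y, (if y = e then 0 else ℓ e y) * Real.exp (t * ‖e.1 - y.1‖) ≤ Λt) (e y : ZdEdge d) :
    (if y = e then 0 else ℓ e y) ≤ Λt := by
  have h0 : ∀ y', 0 ≤ (if y' = e then 0 else ℓ e y') := fun y' => by
    split_ifs with hye
    · exact le_rfl
    · exact hℓ0 e y' hye
  calc (if y = e then 0 else ℓ e y) ≤ (if y = e then 0 else ℓ e y) * Real.exp (t * ‖e.1 - y.1‖) :=
        le_mul_of_one_le_right (h0 y) (Real.one_le_exp (by positivity))
    _ ≤ ∑' y', (if y' = e then 0 else ℓ e y') * Real.exp (t * ‖e.1 - y'.1‖) :=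
        (hℓs e).le_tsum y fun y' _ => mul_nonneg (h0 y') (Real.exp_pos _).le
    _ ≤ Λt := hℓt e

/-- **The weighted cross load against the exponential distance profile**: for a nonnegative vector `δ`
dominated by `K (A 𝟙[y ∈ P] + ∑_{e ∈ S₁} 𝟙[y ≠ e] ℓ(e, y))`, where every link of `P` is within `ℓ^∞`-distance
`1` of `S₁`, diagonal-free weighted rows `∑'_y 𝟙[y ≠ e] ℓ(e, y) e^{t‖e − y‖} ≤ Λ_t`, and a profile bound
`m₀ ≤ dist(e, T)` on `S₁`: `δ` is summable and
`∑'_y e^{−t dist(y, T)} δ(y) ≤ K (A · #P · e^{t} + #S₁ · Λ_t) e^{−t m₀}` — the profile `dist(·, T)` is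
1-Lipschitz (`linkSetDist_le_add_norm`), so the weight `e^{t‖e − y‖}` absorbs the displacement. -/
theorem tsum_exp_profile_modulus_le (hd : 1 ≤ d) (S₁ T P : Finset (ZdEdge d))
    (hP : ∀ y ∈ P, ∃ e ∈ S₁, ‖e.1 - y.1‖ ≤ 1) {t : ℝ} (ht : 0 ≤ t) {ℓ : ZdEdge d → ZdEdge d → ℝ} {Λt : ℝ}
    (hℓ0 : ∀ e y, y ≠ e → 0 ≤ ℓ e y)
    (hℓs : ∀ e, Summable fun y => (if y = e then 0 else ℓ e y) * Real.exp (t * ‖e.1 - y.1‖))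
    (hℓt : ∀ e, ∑' y, (if y = e then 0 else ℓ e y) * Real.exp (t * ‖e.1 - y.1‖) ≤ Λt)
    {m₀ : ℝ} (hm₀ : ∀ e ∈ S₁, m₀ ≤ linkSetDist T e) {A K : ℝ} (hA : 0 ≤ A) (hK : 0 ≤ K)
    {δ : ZdEdge d → ℝ} (hδ0 : ∀ y, 0 ≤ δ y)
    (hδle : ∀ y, δ y ≤ K * (A * (if y ∈ P then 1 else 0) + ∑ e ∈ S₁, (if y = e then 0 else ℓ e y))) :
    Summable δ ∧
      ∑' y, Real.exp (-(t * linkSetDist T y)) * δ y ≤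
        K * (A * P.card * Real.exp t + S₁.card * Λt) * Real.exp (-(t * m₀)) := by
  classical
  have hd0 : 0 < d := hd
  -- the dominating family `g = K (A 𝟙_P + ∑_e ℓ⁰(e, ·))` is summable
  have hℓ00 : ∀ e y, 0 ≤ (if y = e then 0 else ℓ e y) := fun e y => by
    split_ifs with hye
    · exact le_rfl
    · exact hℓ0 e y hye
  have hℓs' : ∀ e, Summable fun y => (if y = e then 0 else ℓ e y) := fun e =>
    Summable.of_nonneg_of_le (hℓ00 e)
      (fun y => le_mul_of_one_le_right (hℓ00 e y) (Real.one_le_exp (by positivity))) (hℓs e)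
  have hind : Summable fun y : ZdEdge d => (if y ∈ P then (1 : ℝ) else 0) :=
    summable_of_ne_finset_zero (s := P) fun y hy => if_neg hy
  have hg : Summable fun y => K * (A * (if y ∈ P then 1 else 0) + ∑ e ∈ S₁, (if y = e then 0 else ℓ e y)) :=
    ((hind.mul_left A).add (summable_sum fun e _ => hℓs' e)).mul_left K
  have hg0 : ∀ y, 0 ≤ A * (if y ∈ P then 1 else 0) + ∑ e ∈ S₁, (if y = e then 0 else ℓ e y) := fun y =>
    add_nonneg (mul_nonneg hA (by split_ifs <;> norm_num)) (Finset.sum_nonneg fun e _ => hℓ00 e y)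
  have hδs : Summable δ := Summable.of_nonneg_of_le hδ0 hδle hg
  refine ⟨hδs, ?_⟩
  -- the weight
  set θ : ZdEdge d → ℝ := fun y => Real.exp (-(t * linkSetDist T y)) with hθ
  have hθ0 : ∀ y, 0 ≤ θ y := fun y => (Real.exp_pos _).le
  have hθ1 : ∀ y, θ y ≤ 1 := fun y => Real.exp_le_one_iff.2 (by nlinarith [linkSetDist_nonneg T y])
  have hθδ : Summable fun y => θ y * δ y :=
    Summable.of_nonneg_of_le (fun y => mul_nonneg (hθ0 y) (hδ0 y))
      (fun y => by simpa using mul_le_mul_of_nonneg_right (hθ1 y) (hδ0 y)) hδs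
  have hθg : Summable fun y => θ y * (K * (A * (if y ∈ P then 1 else 0) + ∑ e ∈ S₁, (if y = e then 0 else ℓ e y))) :=
    Summable.of_nonneg_of_le (fun y => mul_nonneg (hθ0 y) (mul_nonneg hK (hg0 y)))
      (fun y => by simpa using mul_le_mul_of_nonneg_right (hθ1 y) (mul_nonneg hK (hg0 y))) hg
  -- (i) the indicator part: every `y ∈ P` is within `1` of `S₁`, so `θ y ≤ e^{t} e^{-t m₀}`
  have hθP : ∀ y ∈ P, θ y ≤ Real.exp t * Real.exp (-(t * m₀)) := by
    intro y hy
    obtain ⟨e, he, hey⟩ := hP y hy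
    rw [hθ, ← Real.exp_add]
    refine Real.exp_le_exp.2 ?_
    have h1 := linkSetDist_le_add_norm T e y
    have h2 := hm₀ e he
    nlinarith
  have hIpart : ∑' y, θ y * (if y ∈ P then (1 : ℝ) else 0) ≤ P.card * (Real.exp t * Real.exp (-(t * m₀))) := by
    rw [tsum_eq_sum (s := P) (fun y hy => by rw [if_neg hy, mul_zero])]
    calc ∑ y ∈ P, θ y * (if y ∈ P then (1 : ℝ) else 0) = ∑ y ∈ P, θ y :=
          Finset.sum_congr rfl fun y hy => by rw [if_pos hy, mul_one]
      _ ≤ ∑ _y ∈ P, Real.exp t * Real.exp (-(t * m₀)) := Finset.sum_le_sum hθP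
      _ = P.card * (Real.exp t * Real.exp (-(t * m₀))) := by rw [Finset.sum_const, nsmul_eq_mul]
  -- (ii) the cross part: the profile is 1-Lipschitz, the weight absorbs the displacement
  have hXpart : ∀ e ∈ S₁, ∑' y, θ y * (if y = e then 0 else ℓ e y) ≤ Real.exp (-(t * m₀)) * Λt := by
    intro e he
    have hpt : ∀ y, θ y * (if y = e then 0 else ℓ e y) ≤
        Real.exp (-(t * m₀)) * ((if y = e then 0 else ℓ e y) * Real.exp (t * ‖e.1 - y.1‖)) := by
      intro y
      have h1 := linkSetDist_le_add_norm T e y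
      have h2 := hm₀ e he
      have hθy : θ y ≤ Real.exp (-(t * m₀)) * Real.exp (t * ‖e.1 - y.1‖) := by
        rw [hθ, ← Real.exp_add]
        exact Real.exp_le_exp.2 (by nlinarith)
      calc θ y * (if y = e then 0 else ℓ e y)
          ≤ (Real.exp (-(t * m₀)) * Real.exp (t * ‖e.1 - y.1‖)) * (if y = e then 0 else ℓ e y) :=
            mul_le_mul_of_nonneg_right hθy (hℓ00 e y)
        _ = Real.exp (-(t * m₀)) * ((if y = e then 0 else ℓ e y) * Real.exp (t * ‖e.1 - y.1‖)) := by ring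
    have hs1 : Summable fun y => θ y * (if y = e then 0 else ℓ e y) :=
      Summable.of_nonneg_of_le (fun y => mul_nonneg (hθ0 y) (hℓ00 e y))
        (fun y => by simpa using mul_le_mul_of_nonneg_right (hθ1 y) (hℓ00 e y)) (hℓs' e)
    calc ∑' y, θ y * (if y = e then 0 else ℓ e y)
        ≤ ∑' y, Real.exp (-(t * m₀)) * ((if y = e then 0 else ℓ e y) * Real.exp (t * ‖e.1 - y.1‖)) :=
          hs1.tsum_le_tsum hpt ((hℓs e).mul_left _)
      _ = Real.exp (-(t * m₀)) * ∑' y, (if y = e then 0 else ℓ e y) * Real.exp (t * ‖e.1 - y.1‖) :=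
          tsum_mul_left
      _ ≤ Real.exp (-(t * m₀)) * Λt := mul_le_mul_of_nonneg_left (hℓt e) (Real.exp_pos _).le
  -- assemble
  have hsplit : ∑' y, θ y * (K * (A * (if y ∈ P then 1 else 0) + ∑ e ∈ S₁, (if y = e then 0 else ℓ e y))) =
      K * (A * ∑' y, θ y * (if y ∈ P then (1 : ℝ) else 0) +
        ∑ e ∈ S₁, ∑' y, θ y * (if y = e then 0 else ℓ e y)) := by
    have hsθ1 : Summable fun y => θ y * (if y ∈ P then (1 : ℝ) else 0) :=
      Summable.of_nonneg_of_le (fun y => mul_nonneg (hθ0 y) (by split_ifs <;> norm_num))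
        (fun y => by simpa using mul_le_mul_of_nonneg_right (hθ1 y) (by split_ifs <;> norm_num : (0:ℝ) ≤ (if y ∈ P then (1 : ℝ) else 0))) hind
    have hsθe : ∀ e ∈ S₁, Summable fun y => θ y * (if y = e then 0 else ℓ e y) := fun e _ =>
      Summable.of_nonneg_of_le (fun y => mul_nonneg (hθ0 y) (hℓ00 e y))
        (fun y => by simpa using mul_le_mul_of_nonneg_right (hθ1 y) (hℓ00 e y)) (hℓs' e)
    have hpt : ∀ y, θ y * (K * (A * (if y ∈ P then 1 else 0) + ∑ e ∈ S₁, (if y = e then 0 else ℓ e y))) =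
        K * (A * (θ y * (if y ∈ P then (1 : ℝ) else 0)) + ∑ e ∈ S₁, θ y * (if y = e then 0 else ℓ e y)) :=
      fun y => by rw [← Finset.mul_sum]; ring
    rw [tsum_congr hpt, tsum_mul_left, ((hsθ1.mul_left A)).tsum_add (summable_sum hsθe), tsum_mul_left,
      Summable.tsum_finsetSum hsθe]
  calc ∑' y, θ y * δ y
      ≤ ∑' y, θ y * (K * (A * (if y ∈ P then 1 else 0) + ∑ e ∈ S₁, (if y = e then 0 else ℓ e y))) :=
        hθδ.tsum_le_tsum (fun y => mul_le_mul_of_nonneg_left (hδle y) (hθ0 y)) hθg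
    _ = K * (A * ∑' y, θ y * (if y ∈ P then (1 : ℝ) else 0) +
          ∑ e ∈ S₁, ∑' y, θ y * (if y = e then 0 else ℓ e y)) := hsplit
    _ ≤ K * (A * (P.card * (Real.exp t * Real.exp (-(t * m₀)))) +
          ∑ _e ∈ S₁, Real.exp (-(t * m₀)) * Λt) := by
        refine mul_le_mul_of_nonneg_left (add_le_add (mul_le_mul_of_nonneg_left hIpart hA)
          (Finset.sum_le_sum hXpart)) hK
    _ = K * (A * P.card * Real.exp t + S₁.card * Λt) * Real.exp (-(t * m₀)) := by
        rw [Finset.sum_const, nsmul_eq_mul]; ring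

/-! ### The global summable Lipschitz vector of the tier-2 smoothing and its weighted profile sums -/

section SUN

variable {W : Potential (ZdEdge d) (Matrix.specialUnitaryGroup (Fin N) ℂ)} {B : Finset (ZdEdge d) → ℝ}

/-- **The tier-2 smoothing of a bounded local observable is QUASILOCAL with a GLOBAL SUMMABLE Lipschitz
vector whose exponential-profile sums decay** (`SU(N)`, `N ≥ 1`, every `d ≥ 1`, tree coupling `b`): for a
summable member with continuous own-link terms, Lipschitz witnesses with summable cross moduli dominated off
the diagonal by `ℓ(e, y)`, and diagonal-free weighted rows `∑'_y 𝟙[y ≠ e] ℓ(e, y) e^{t‖e − y‖} ≤ Λ_t`, every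
`F` measurable, depending only on the links of `S₁`, `|F| ≤ M`, admits `δ ≥ 0` summable with
`|γ^W_{S₁}F(σ) − γ^W_{S₁}F(τ)| ≤ ∑'_y δ(y) ‖σ_y − τ_y‖_F` for ALL `σ, τ`, and a constant `Φ ≥ 0` with
`∑'_y e^{−t dist(y, T)} δ(y) ≤ Φ e^{−t m₀}` whenever `dist(e, T) ≥ m₀` on `S₁`
(`isLipBound_specAvg_perturbedYMS` + `specAvg_perturbedYMS_quasilocal` +
`abs_sub_le_tsum_of_isLipBound_of_quasilocal` + `tsum_exp_profile_modulus_le`). -/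
theorem exists_globalLip_specAvg_perturbedYMS (hd : 1 ≤ d) (hN : 1 ≤ N) (b : ℝ) {Λt t : ℝ}
    (h : IsLinkSummable W B) (hWc : ∀ X, Continuous (W X))
    (hWdep : ∀ X, DependsOn (W X) (↑X : Set (ZdEdge d)))
    {lip : Finset (ZdEdge d) → ZdEdge d → ℝ} (hlip : ∀ X, IsLipBound suFrobDist (W X) (lip X))
    {ℓ : ZdEdge d → ZdEdge d → ℝ}
    (hlips : ∀ e y, Summable fun X : Finset (ZdEdge d) => (if e ∈ X ∧ y ∈ X then lip X y else 0))
    (hℓ : ∀ e y, y ≠ e → ∑' X : Finset (ZdEdge d), (if e ∈ X ∧ y ∈ X then lip X y else 0) ≤ ℓ e y)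
    (ht : 0 ≤ t) (hℓs : ∀ e, Summable fun y => (if y = e then 0 else ℓ e y) * Real.exp (t * ‖e.1 - y.1‖))
    (hℓt : ∀ e, ∑' y, (if y = e then 0 else ℓ e y) * Real.exp (t * ‖e.1 - y.1‖) ≤ Λt)
    (S₁ : Finset (ZdEdge d)) {F : LGConfig d (Matrix.specialUnitaryGroup (Fin N) ℂ) → ℝ} (hFm : Measurable F)
    (hFdep : DependsOn F (↑S₁ : Set (ZdEdge d))) {M : ℝ} (hM : ∀ U, |F U| ≤ M) :
    ∃ (δ : ZdEdge d → ℝ) (Φ : ℝ), 0 ≤ Φ ∧ (∀ y, 0 ≤ δ y) ∧ Summable δ ∧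
      (∀ σ τ, |specAvg (perturbedYMS (fundamentalRep (Fin N)) b W) S₁ F σ -
          specAvg (perturbedYMS (fundamentalRep (Fin N)) b W) S₁ F τ| ≤ ∑' y, δ y * suFrobDist (σ y) (τ y)) ∧
      (∀ (T : Finset (ZdEdge d)) (m₀ : ℝ), (∀ e ∈ S₁, m₀ ≤ linkSetDist T e) →
        ∑' y, Real.exp (-(t * linkSetDist T y)) * δ y ≤ Φ * Real.exp (-(t * m₀))) := by
  classical
  have hN0 : (0 : ℝ) < N := by exact_mod_cast hN
  -- the loads: nonnegativity, the cross coefficient is bounded by the weighted row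
  have hlip0 : ∀ X z, 0 ≤ lip X z := fun X z => (hlip X).nonneg z
  have hℓ0 : ∀ e y, y ≠ e → 0 ≤ ℓ e y := fun e y hye => by
    refine le_trans (tsum_nonneg fun X => ?_) (hℓ e y hye)
    split_ifs
    · exact hlip0 X y
    · exact le_rfl
  have hℓ00 : ∀ e y, 0 ≤ (if y = e then 0 else ℓ e y) := fun e y => by
    split_ifs with hye
    · exact le_rfl
    · exact hℓ0 e y hye
  have hℓΛ : ∀ e y, (if y = e then 0 else ℓ e y) ≤ Λt := crossCoeff_le_of_weighted_row hℓ0 ht hℓs hℓt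
  have hM0 : 0 ≤ M := (abs_nonneg _).trans (hM fun _ => 1)
  -- the moduli of the energy in the outside links of `S₁`
  set P₁ : Finset (ZdEdge d) := (plaquettesTouching S₁).biUnion plaquetteEdges with hP₁
  set A : ℝ := |b| * (((2 * (d - 1) : ℕ) : ℝ) * Real.sqrt N) with hAdef
  have hA0 : 0 ≤ A := by positivity
  set m : ZdEdge d → ℝ := fun y => if y ∈ S₁ then 0 else
    (A * (if y ∈ P₁ then 1 else 0) + ∑ e ∈ S₁, (if y = e then 0 else ℓ e y)) with hmdef
  have hin0 : ∀ y, 0 ≤ A * (if y ∈ P₁ then 1 else 0) + ∑ e ∈ S₁, (if y = e then 0 else ℓ e y) := fun y =>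
    add_nonneg (mul_nonneg hA0 (by split_ifs <;> norm_num)) (Finset.sum_nonneg fun e _ => hℓ00 e y)
  have hm0 : ∀ y, 0 ≤ m y := fun y => by
    by_cases hy : y ∈ S₁
    · simp only [hmdef, if_pos hy]; exact le_rfl
    · simp only [hmdef, if_neg hy]; exact hin0 y
  set L : ℝ := A + S₁.card * Λt + 1 with hLdef
  have hΛt0 : 0 ≤ Λt := by
    obtain ⟨e⟩ : Nonempty (ZdEdge d) := ⟨((0 : Site d), (⟨0, hd⟩ : Fin d))⟩
    exact (hℓ00 e e).trans (hℓΛ e e)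
  have hL : 0 < L := by positivity
  have hmL : ∀ y, m y ≤ L := fun y => by
    have hsum : ∑ e ∈ S₁, (if y = e then 0 else ℓ e y) ≤ S₁.card * Λt := by
      calc ∑ e ∈ S₁, (if y = e then 0 else ℓ e y) ≤ ∑ _e ∈ S₁, Λt := Finset.sum_le_sum fun e _ => hℓΛ e y
        _ = S₁.card * Λt := by rw [Finset.sum_const, nsmul_eq_mul]
    have hind : A * (if y ∈ P₁ then (1 : ℝ) else 0) ≤ A :=
      mul_le_of_le_one_right hA0 (by split_ifs <;> norm_num)
    by_cases hy : y ∈ S₁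
    · simp only [hmdef, if_pos hy]; exact hL.le
    · simp only [hmdef, if_neg hy]; linarith
  have hE : ∀ y, y ∉ S₁ → ∀ U V : LGConfig d (Matrix.specialUnitaryGroup (Fin N) ℂ),
      (∀ z, z ≠ y → U z = V z) →
        |perturbedEnergyS (fundamentalRep (Fin N)) b W S₁ U -
            perturbedEnergyS (fundamentalRep (Fin N)) b W S₁ V| ≤ m y * suFrobDist (U y) (V y) := by
    intro y hy U V hUV
    refine (abs_perturbedEnergyS_sub_le_of_eq_off b h hWdep hlip S₁ (fun e _ => hlips e y) hUV).trans ?_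
    refine mul_le_mul_of_nonneg_right ?_ (suFrobDist_nonneg _ _)
    simp only [hmdef, if_neg hy]
    refine add_le_add le_rfl (Finset.sum_le_sum fun e he => ?_)
    have hye : y ≠ e := fun hye => hy (hye ▸ he)
    rw [if_neg hye]
    exact hℓ e y hye
  -- the smoothing: sitewise Lipschitz, quasilocal ⇒ global Lipschitz
  set K : ℝ := (Real.exp (2 * (2 * Real.sqrt N) * L) - 1) / ((2 * Real.sqrt N) * L) with hKdef
  have hK0 : 0 ≤ K := div_nonneg (sub_nonneg.2 (Real.one_le_exp (by positivity))) (by positivity)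
  set δ₁ : ZdEdge d → ℝ := fun y => if y ∈ S₁ then 0 else M * K * m y with hδ₁def
  have hδ₁lip : IsLipBound suFrobDist (specAvg (perturbedYMS (fundamentalRep (Fin N)) b W) S₁ F) δ₁ :=
    isLipBound_specAvg_perturbedYMS hN b h hWc S₁ hL hm0 hmL hE hFm hFdep hM
  have hδ₁0 : ∀ y, 0 ≤ δ₁ y := hδ₁lip.nonneg
  have hδ₁le : ∀ y, δ₁ y ≤ (M * K) * (A * (if y ∈ P₁ then 1 else 0) + ∑ e ∈ S₁, (if y = e then 0 else ℓ e y)) := by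
    intro y
    by_cases hy : y ∈ S₁
    · simp only [hδ₁def, if_pos hy]
      exact mul_nonneg (mul_nonneg hM0 hK0) (hin0 y)
    · simp only [hδ₁def, hmdef, if_neg hy]
      exact le_rfl
  have hP₁near : ∀ y ∈ P₁, ∃ e ∈ S₁, ‖e.1 - y.1‖ ≤ 1 := by
    intro y hy
    obtain ⟨p, hp, hyp⟩ := Finset.mem_biUnion.1 hy
    obtain ⟨e, he⟩ := mem_plaquettesTouching_iff.1 hp
    obtain ⟨hep, heS⟩ := Finset.mem_inter.1 he
    exact ⟨e, heS, norm_sub_le_one_of_mem_plaquetteEdges hep hyp⟩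
  have hδ₁s : Summable δ₁ :=
    (tsum_exp_profile_modulus_le hd S₁ S₁ P₁ hP₁near ht hℓ0 hℓs hℓt (m₀ := 0) (fun e _ => linkSetDist_nonneg _ _)
      hA0 (mul_nonneg hM0 hK0) hδ₁0 hδ₁le).1
  have hql := specAvg_perturbedYMS_quasilocal b h hWc hWdep S₁ hFm hFdep hM
  refine ⟨δ₁, (M * K) * (A * P₁.card * Real.exp t + S₁.card * Λt), by positivity, hδ₁0, hδ₁s,
    abs_sub_le_tsum_of_isLipBound_of_quasilocal (fun _ _ => suFrobDist_nonneg _ _) suFrobDist_le hδ₁lip hδ₁s hql,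
    fun T m₀ hm₀ => ?_⟩
  exact (tsum_exp_profile_modulus_le hd S₁ T P₁ hP₁near ht hℓ0 hℓs hℓt hm₀ hA0 (mul_nonneg hM0 hK0) hδ₁0 hδ₁le).2

end SUN

end Summit.Ventures.YMGap.RobustBall

end
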